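import Literature.Computability.QuantumComplexity.ForrelationDerivativeTables

/-!
# Crux `CubicForrelation.NearExactIsExact` (stmt-QuantumAdvantage-14043), line `direct-sum-amplification` —
helper `cc_concat_hasMSubspace`: the 4-concatenation inherits an M-subspace

The **4-concatenation** `G = g₁ ‖ g₂ ‖ g₂ ‖ ¬g₁` of two Boolean functions `g₁, g₂` on `n` bits is the
function on `n + 2` bits

  `G(x, a, b) = g₁(x) ⊕ (a ⊕ b)·(g₁(x) ⊕ g₂(x)) ⊕ a·b`

(`x` = the first `n` coordinates, read through `Fin.castAdd 2`; `a, b` = the two extra coordinates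
`Fin.natAdd n 0`, `Fin.natAdd n 1`). It is the one known lever producing new forrelation values next
to `1` (the averaging identity `Φ(F, G) = (Φ(d₁, g₁) + Φ(c, g₂))/2` of
`CubicForrelationNearExactIsExactConcatAveraging.lean`). An **M-subspace** for `g` is an xor-closed
finset `V ∋ 0` of directions along which all second derivatives of `g` vanish,
`g(y) ⊕ g(y ⊕ u) ⊕ g(y ⊕ v) ⊕ g(y ⊕ u ⊕ v) = 0` for `u, v ∈ V` (i.e. `g` is affine on every coset of
`V`; for Maiorana–McFarland-shaped `g` on `n = 2m` bits, `|V| = 2^m`).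

`cc_concat_hasMSubspace` ROUTES concatenations back to that shape: if `g₁` AND `g₂` admit the same
M-subspace `V`, then `G` admits the M-subspace

  `V' = {v ‖ (ε, ε) : v ∈ V, ε ∈ {0,1}}`,  `|V'| = 2·|V|`

(so `|V|² = 2ⁿ` upgrades to `|V'|² = 2^{n+2}`).

Proof. `V'` is the image of `V × Bool` under the injective map `(v, ε) ↦ v ‖ (ε, ε)`
(`cc_append_injective`), hence has `2·|V|` elements; it contains `0 = 0 ‖ (0,0)` (`cc_append_zeroVec`)
and is xor-closed coordinatewise (`cc_bxor_append`). For the 4-point condition write `y = x ‖ (a, b)`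
and move by `u = v ‖ (ε, ε)`: then `x ↦ x ⊕ v`, `(a, b) ↦ (a ⊕ ε, b ⊕ ε)`, so `s := a ⊕ b` is invariant
on the coset while `a·b ↦ a·b ⊕ ε·s ⊕ ε`. Hence along `V'` the function
`G = g₁(x) ⊕ s·(g₁ ⊕ g₂)(x) ⊕ a·b` is [affine in `x` along `V`, by the hypothesis on `g₁` if `s = 0` and on
`g₂` if `s = 1`] `⊕` [affine in `ε`], and its second difference along `u = v ‖ (ε,ε)`, `u' = v' ‖ (ε',ε')`
vanishes. In Lean this is the finite Boolean identity `cc_bool_key` (the eight values of `g₁, g₂` at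
`x, x ⊕ v, x ⊕ v', x ⊕ v ⊕ v'` and `a, b, ε, ε'` are generalised to twelve Booleans; `decide`), after the
block accessors `Fin.append_left` / `Fin.append_right` have been rewritten.

References (orientation only; everything below is proved from scratch, axioms standard): the secondary
construction `f ‖ g ‖ g ‖ f ⊕ 1` of bent functions, C. Carlet, *Boolean Functions for Cryptography and
Coding Theory*, CUP 2021, §6.1; Maiorana–McFarland functions and their affine cosets, ibid. §6.1.
Imports: only `Literature.Computability.QuantumComplexity.ForrelationDerivativeTables` (for `bxor`,
`zeroVec`); the Theses file is deliberately NOT imported.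
-/

set_option linter.dupNamespace false -- D-0017: single-problem summit

namespace Summit.QuantumAdvantage.QuantumAdvantage.Theorems.CubicForrelation.NearExactIsExact

open Finset
open Literature.Computability.QuantumComplexity
open Literature.Computability.QuantumComplexity.BuzetChailloux (bxor zeroVec)

variable {n : ℕ}

/-! ### Padding an `n`-bit vector by a constant pair of bits -/

/-- `0 ‖ (0, 0) = 0`: the zero vector of length `n` padded by two `false` bits is the zero vector of
length `n + 2`. -/
theorem cc_append_zeroVec :
    Fin.append (zeroVec : Fin n → Bool) (fun _ : Fin 2 => false) = (zeroVec : Fin (n + 2) → Bool) := by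
  funext i
  refine Fin.addCases (fun j => ?_) (fun j => ?_) i
  · simp [zeroVec]
  · simp [zeroVec]

/-- Padding commutes with xor: `(v ‖ (ε,ε)) ⊕ (v' ‖ (ε',ε')) = (v ⊕ v') ‖ (ε ⊕ ε', ε ⊕ ε')`. -/
theorem cc_bxor_append (v v' : Fin n → Bool) (ε ε' : Bool) :
    bxor (Fin.append v (fun _ : Fin 2 => ε)) (Fin.append v' (fun _ : Fin 2 => ε')) =
      Fin.append (bxor v v') (fun _ : Fin 2 => ε ^^ ε') := by
  funext i
  refine Fin.addCases (fun j => ?_) (fun j => ?_) i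
  · simp [bxor]
  · simp [bxor]

/-- The padding map `(v, ε) ↦ v ‖ (ε, ε)` is injective. -/
theorem cc_append_injective :
    Function.Injective (fun p : (Fin n → Bool) × Bool => Fin.append p.1 (fun _ : Fin 2 => p.2)) := by
  rintro ⟨v, ε⟩ ⟨v', ε'⟩ h
  have h' : Fin.append v (fun _ : Fin 2 => ε) = Fin.append v' (fun _ : Fin 2 => ε') := h
  have hv : v = v' := by
    funext i
    simpa using congrFun h' (Fin.castAdd 2 i)
  have hε : ε = ε' := by
    simpa using congrFun h' (Fin.natAdd n 0)
  cases hv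
  cases hε
  rfl

/-! ### The finite Boolean core of the 4-point condition -/

/-- **The Boolean core.** With `A, B, C, D` (resp. `A₂, B₂, C₂, D₂`) the values of `g₁` (resp. `g₂`) at
`x, x ⊕ v, x ⊕ v', x ⊕ v ⊕ v'`, and `(a, b)` the two extra bits moved by `(ε, ε)`, `(ε', ε')`,
`(ε ⊕ ε', ε ⊕ ε')`: if both 4-point sums `A ⊕ B ⊕ C ⊕ D`, `A₂ ⊕ B₂ ⊕ C₂ ⊕ D₂` vanish, so does the 4-point
sum of `G = g₁ ⊕ (a ⊕ b)(g₁ ⊕ g₂) ⊕ ab`. (`a ⊕ b` is invariant; checked by `decide` after splitting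
`a, b, ε, ε'`.) -/
theorem cc_bool_key : ∀ (a b ε ε' A B C D A₂ B₂ C₂ D₂ : Bool),
    (A ^^ B ^^ C ^^ D) = false → (A₂ ^^ B₂ ^^ C₂ ^^ D₂) = false →
    (xor (xor A ((xor a b) && (xor A A₂))) (a && b) ^^
      xor (xor B ((xor (a ^^ ε) (b ^^ ε)) && (xor B B₂))) ((a ^^ ε) && (b ^^ ε)) ^^
      xor (xor C ((xor (a ^^ ε') (b ^^ ε')) && (xor C C₂))) ((a ^^ ε') && (b ^^ ε')) ^^
      xor (xor D ((xor (a ^^ (ε ^^ ε')) (b ^^ (ε ^^ ε'))) && (xor D D₂)))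
        ((a ^^ (ε ^^ ε')) && (b ^^ (ε ^^ ε')))) = false := by
  intro a b ε ε'
  cases a <;> cases b <;> cases ε <;> cases ε' <;> decide

/-! ### The statement -/

/-- **The 4-concatenation inherits an M-subspace.** If `g₁` and `g₂` are both affine on the cosets of
the same xor-closed finset `V ∋ 0` (all second derivatives along `V` vanish), then the 4-concatenation
`G(x,a,b) = g₁(x) ⊕ (a ⊕ b)(g₁ ⊕ g₂)(x) ⊕ ab` (`= g₁ ‖ g₂ ‖ g₂ ‖ ¬g₁`) on `n + 2` bits is affine on the
cosets of an xor-closed finset `V' ∋ 0` with `|V'| = 2|V|`, namely `V' = {v ‖ (ε,ε) : v ∈ V, ε ∈ Bool}`. -/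
theorem cc_concat_hasMSubspace : ∀ (n : ℕ) (g₁ g₂ : (Fin n → Bool) → Bool) (V : Finset (Fin n → Bool)), zeroVec ∈ V → (∀ x ∈ V, ∀ y ∈ V, bxor x y ∈ V) → (∀ u ∈ V, ∀ v ∈ V, ∀ y, (g₁ y ^^ g₁ (bxor y u) ^^ g₁ (bxor y v) ^^ g₁ (bxor y (bxor u v))) = false) → (∀ u ∈ V, ∀ v ∈ V, ∀ y, (g₂ y ^^ g₂ (bxor y u) ^^ g₂ (bxor y v) ^^ g₂ (bxor y (bxor u v))) = false) → ∃ V' : Finset (Fin (n + 2) → Bool), zeroVec ∈ V' ∧ (∀ x ∈ V', ∀ y ∈ V', bxor x y ∈ V') ∧ V'.card = 2 * V.card ∧ ∀ u ∈ V', ∀ v ∈ V', ∀ y, ((fun y : Fin (n + 2) → Bool => xor (xor (g₁ fun i => y (Fin.castAdd 2 i)) ((xor (y (Fin.natAdd n 0)) (y (Fin.natAdd n 1))) && (xor (g₁ fun i => y (Fin.castAdd 2 i)) (g₂ fun i => y (Fin.castAdd 2 i))))) (y (Fin.natAdd n 0) && y (Fin.natAdd n 1))) y ^^ (fun y : Fin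 (n + 2) → Bool => xor (xor (g₁ fun i => y (Fin.castAdd 2 i)) ((xor (y (Fin.natAdd n 0)) (y (Fin.natAdd n 1))) && (xor (g₁ fun i => y (Fin.castAdd 2 i)) (g₂ fun i => y (Fin.castAdd 2 i))))) (y (Fin.natAdd n 0) && y (Fin.natAdd n 1))) (bxor y u) ^^ (fun y : Fin (n + 2) → Bool => xor (xor (g₁ fun i => y (Fin.castAdd 2 i)) ((xor (y (Fin.natAdd n 0)) (y (Fin.natAdd n 1))) && (xor (g₁ fun i => y (Fin.castAdd 2 i)) (g₂ fun i => y (Fin.castAdd 2 i))))) (y (Fin.natAdd n 0) && y (Fin.natAdd n 1))) (bxor y v) ^^ (fun y : Fin (n + 2) → Bool => xor (xor (g₁ fun i => y (Fin.castAdd 2 i)) ((xor (y (Fin.natAdd n 0)) (y (Fin.natAdd n 1))) && (xor (g₁ fun i => y (Fin.castAdd 2 i)) (g₂ fun i => y (Fin.castAdd 2 i))))) (y (Fin.natAdd n 0) && y (Fin.natAdd n 1))) (bxor y (bxor u v))) = false := by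
  intro n g₁ g₂ V h0 hV h₁ h₂
  refine ⟨(V ×ˢ (univ : Finset Bool)).image
      (fun p : (Fin n → Bool) × Bool => Fin.append p.1 (fun _ : Fin 2 => p.2)), ?_, ?_, ?_, ?_⟩
  · -- `0 = 0 ‖ (0,0) ∈ V'`
    exact mem_image.2 ⟨(zeroVec, false), mem_product.2 ⟨h0, mem_univ _⟩, cc_append_zeroVec⟩
  · -- xor-closure, coordinatewise
    intro x hx y hy
    simp only [mem_image, mem_product, mem_univ, and_true, Prod.exists] at hx hy ⊢
    obtain ⟨v, ε, hv, rfl⟩ := hx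
    obtain ⟨v', ε', hv', rfl⟩ := hy
    exact ⟨bxor v v', ε ^^ ε', hV v hv v' hv', (cc_bxor_append v v' ε ε').symm⟩
  · -- `|V'| = |V × Bool| = 2|V|`
    rw [card_image_of_injective _ cc_append_injective, card_product, card_univ, Fintype.card_bool,
      mul_comm]
  · -- the 4-point condition along `V'`
    intro u hu u' hu' y
    simp only [mem_image, mem_product, mem_univ, and_true, Prod.exists] at hu hu'
    obtain ⟨v, ε, hv, rfl⟩ := hu
    obtain ⟨v', ε', hv', rfl⟩ := hu'
    simp only [bxor, Fin.append_left, Fin.append_right]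
    exact cc_bool_key _ _ _ _ _ _ _ _ _ _ _ _ (h₁ v hv v' hv' fun i => y (Fin.castAdd 2 i))
      (h₂ v hv v' hv' fun i => y (Fin.castAdd 2 i))

end Summit.QuantumAdvantage.QuantumAdvantage.Theorems.CubicForrelation.NearExactIsExact
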